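import Summits.AnomalousDissipation.AnomalousDissipation.Theorems.SolenoidalFractalHomogenisationLagrangianCarrierConstructionRegularLDistortion
import HarnessLib

/-!
# Uniform WINDOW DISTORTION of the coarse Lagrangian flows of an `LPermissible`, `Regular` carrier under the strain-budget ceiling
# (export of the K3L distortion tower for K1L `stub_tailL`; helper, `--supports stmt-AnomalousDissipation-24912`)

Summits-side helper file (everything proved; no definitions, no named facts). The distortion tower of crux K3L
(`…RegularLDistortion.distortion_tower`, stmt-AnomalousDissipation-24913, closed) is stated under the twenty-two binders of `stub_regularL`; the
tail step `stub_tailL` of crux K1L (stmt-AnomalousDissipation-24912, skeleton v17+: `∃ Λ₁ ∃ θs, … θ₀ ≤ θs → …`) meets the SAME carrier through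
`E.LPermissible` (⊇ `IsLagrangian`, (W1), (W2), (S), (DEC)) and `E.Regular` (⊇ the qualitative clauses of `LevelRegular`) plus the K1L template
(`N_m² ≤ N_{m+1}`, (T4) `θ_{m+1} (N_{m+1}/N_m)^{1/16} ≤ θ₀`). This file repackages the tower in that vocabulary — the shared interface fixed by the
tenure planner (WORKER FIT 2026-08-28T11:50Z: "the tailL worker CONSUMES the taker's `hδ` shape verbatim … never a second tower"):
for every design `W` there is `θs(k, W) > 0` such that, whenever `θ₀ ≤ θs`, for every level `m` and all `s, t` in one refresh window of level
`m+1`, `‖D Φ_m(s→t)(z) − I‖ ≤ 1/10` (`window_distortion_le`, evolution-map form `hδ`), hence `‖flowDeriv m t (j R_{m+1}) y − id‖ ≤ 1/10` and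
`‖flowDeriv m t (j R_{m+1}) y‖ ≤ 11/10` on the windows (`flowDeriv_window_distortion_le`, the `UniformFlowDistortion E (11/10)` shape of advisory
R23-2). Infrastructure for route-1's rung leaf F-D1.A0 (a frontier FORMAL rung); NOT a proof of anomalous dissipation.
[cite: ArmstrongVicol2025, Prop. 2.2 (p. 19) and Cor. 2.4 (p. 22: ‖∇X_m − I‖ ≤ 1/4 on the refresh windows); §5.1]
-/

set_option linter.dupNamespace false

noncomputable section

namespace Summit.AnomalousDissipation.AnomalousDissipation.Theorems.SolenoidalFractalHomogenisation.LagrangianCarrierConstruction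

open Set Function Filter Topology MeasureTheory
open scoped NNReal ContDiff
open Literature.Analysis Literature.Analysis.ODE Literature.Analysis.FunctionSpaces Literature.Analysis.FunctionSpaces.Torus
open Literature.Analysis.FluidPDE Literature.Analysis.FluidPDE.LatticeShear

variable {k : ℕ}

/-- **Uniform window distortion under the ceiling (evolution-map form).** For every design `W` there is `θs > 0` such that for every
`LPermissible`, `Regular` carrier with design `W`, separation `N_m² ≤ N_{m+1}`, template (T4) at `θ₀ ≤ θs`: for all `s, t` in one window of level
`m+1`, `‖DΦ_m(s→t)(z) − I‖ ≤ 1/10`, where `Φ_m(s→t) = evolutionMap (b_{≤m} ∘ proj) s t`.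
[cite: ArmstrongVicol2025, Cor. 2.4 (p. 22)] -/
theorem window_distortion_le (k : ℕ) (W : LatticeWord k) : ∃ θs : ℝ, 0 < θs ∧
    ∀ (E : LagrangianLatticeCarrier k) (θ₀ : ℝ), E.design = W → θ₀ ≤ θs → E.LPermissible → E.Regular →
      (∀ m, E.N m ^ 2 ≤ E.N (m + 1)) → (∀ m, E.θ (m + 1) * ((E.N (m + 1) : ℝ) / E.N m) ^ (1 / 16 : ℝ) ≤ θ₀) →
      ∀ (m : ℕ) (j : ℤ) (s t : ℝ), s ∈ E.window (m + 1) j → t ∈ E.window (m + 1) j → ∀ z : EuclideanSpace ℝ (Fin 3),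
        ‖fderiv ℝ (evolutionMap (fun t (z : EuclideanSpace ℝ (Fin 3)) => E.partialSum m t (proj z)) s t) z -
          ContinuousLinearMap.id ℝ (EuclideanSpace ℝ (Fin 3))‖ ≤ 1 / 10 := by
  obtain ⟨L, hL0, hL2W⟩ := exists_levelHessianConst W
  refine ⟨min 1 (min (1 / (60 * (Real.sqrt 3 * (3 * (k : ℝ))) + 1)) (1 / (66 * (L * ((k : ℝ) / (2 * Real.pi))) + 1))),
    lt_min one_pos (lt_min (by positivity) (by positivity)), ?_⟩
  intro E θ₀ hD hθs hLP hReg hsq hT4 m j s t hs ht z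
  have hP := hLP.permissible
  have hLag := hLP.isLagrangian
  have hLR := hReg.levelRegular
  set M : ℝ := Real.sqrt 3 * (3 * (k : ℝ)) with hM
  set U : ℝ := (k : ℝ) / (2 * Real.pi) with hU
  have hM0 : 0 ≤ M := by positivity
  have hU0 : 0 ≤ U := by positivity
  have hN0 : E.N 0 = 1 := hP.1
  have hN2 : ∀ m, 2 * E.N m ≤ E.N (m + 1) := hP.2.2.1
  have hNpos : ∀ m, (0 : ℝ) < E.N m := fun m => by exact_mod_cast E.toFractalCarrierData.N_pos m
  have hNmono : ∀ m, (E.N m : ℝ) ≤ E.N (m + 1) := fun m => by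
    have h : (2 : ℝ) * E.N m ≤ E.N (m + 1) := by exact_mod_cast hN2 m
    linarith [hNpos m]
  have hθ : ∀ m, E.θ (m + 1) ≤ θ₀ := fun m => by
    have hr : (1 : ℝ) ≤ ((E.N (m + 1) : ℝ) / E.N m) ^ (1 / 16 : ℝ) :=
      Real.one_le_rpow ((one_le_div (hNpos m)).2 (hNmono m)) (by norm_num)
    calc E.θ (m + 1) = E.θ (m + 1) * 1 := (mul_one _).symm
      _ ≤ E.θ (m + 1) * ((E.N (m + 1) : ℝ) / E.N m) ^ (1 / 16 : ℝ) := mul_le_mul_of_nonneg_left hr (E.θ_pos _).le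
      _ ≤ θ₀ := hT4 m
  have hθ0 : 0 < θ₀ := (E.θ_pos 1).trans_le (hθ 0)
  have hθ1 : θ₀ ≤ 1 := hθs.trans (min_le_left _ _)
  have hθM : 60 * (M * θ₀) ≤ 1 := by
    have h : θ₀ ≤ 1 / (60 * M + 1) := hθs.trans ((min_le_right _ _).trans (min_le_left _ _))
    rw [le_div_iff₀ (by positivity)] at h
    nlinarith
  have hθL : 66 * (L * U * θ₀) ≤ 1 := by
    have h : θ₀ ≤ 1 / (66 * (L * U) + 1) := hθs.trans ((min_le_right _ _).trans (min_le_right _ _))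
    rw [le_div_iff₀ (by positivity)] at h
    nlinarith [mul_nonneg hL0 hU0]
  have tower := distortion_tower E θ₀ hLag hLR.continuous_uncurry_b hLR.isSmooth_b hLR.exists_norm_iteratedFDeriv_b_le
    hLR.continuous_disp hLR.isSmooth_disp hLP.refresh_nested hLP.strain_le hθ hN0 hN2 hsq hL0 (hL2W E.toFractalCarrierData hD)
    hθ1 hθM hθL
  exact (tower m j s t hs ht).2.1 z

/-- **Uniform window distortion under the ceiling (`flowDeriv` form).** Same `θs`; on every refresh window of level `m+1` with left end
`w = j · refresh (m+1)`: `‖flowDeriv m t w y − id‖ ≤ 1/10` and `‖flowDeriv m t w y‖ ≤ 11/10` — the `UniformFlowDistortion E (11/10)` shape.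
[cite: ArmstrongVicol2025, Cor. 2.4 (p. 22)] -/
theorem flowDeriv_window_distortion_le (k : ℕ) (W : LatticeWord k) : ∃ θs : ℝ, 0 < θs ∧
    ∀ (E : LagrangianLatticeCarrier k) (θ₀ : ℝ), E.design = W → θ₀ ≤ θs → E.LPermissible → E.Regular →
      (∀ m, E.N m ^ 2 ≤ E.N (m + 1)) → (∀ m, E.θ (m + 1) * ((E.N (m + 1) : ℝ) / E.N m) ^ (1 / 16 : ℝ) ≤ θ₀) →
      ∀ (m : ℕ) (j : ℤ), ∀ t ∈ E.window (m + 1) j, ∀ y : UnitAddTorus (Fin 3),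
        ‖E.flowDeriv m t ((j : ℝ) * E.refresh (m + 1)) y - ContinuousLinearMap.id ℝ (EuclideanSpace ℝ (Fin 3))‖ ≤ 1 / 10 ∧
        ‖E.flowDeriv m t ((j : ℝ) * E.refresh (m + 1)) y‖ ≤ 11 / 10 := by
  obtain ⟨θs, hθs, H⟩ := window_distortion_le k W
  refine ⟨θs, hθs, fun E θ₀ hD hθ hLP hReg hsq hT4 m j t ht y => ?_⟩
  have hLR := hReg.levelRegular
  have hδ := H E θ₀ hD hθ hLP hReg hsq hT4 m j _ t (left_mem_window E (m + 1) j) ht (repr y)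
  rw [fderiv_evolutionMap_partialSum E m (hLP.isLagrangian m).1 hLR.continuous_uncurry_b hLR.isSmooth_b
    hLR.exists_norm_iteratedFDeriv_b_le hLR.continuous_disp hLR.isSmooth_disp, proj_repr] at hδ
  refine ⟨hδ, ?_⟩
  have h := Summit.AnomalousDissipation.AnomalousDissipation.Theorems.SolenoidalFractalHomogenisation.LagrangianCarrier.norm_le_one_add_norm_sub_id
    (E.flowDeriv m t ((j : ℝ) * E.refresh (m + 1)) y)
  linarith

end Summit.AnomalousDissipation.AnomalousDissipation.Theorems.SolenoidalFractalHomogenisation.LagrangianCarrierConstruction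

end
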